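import Summits.ABC.IUTFork.Repair.RcatGeigerProductIdentity
import Mathlib.Analysis.SpecialFunctions.Log.Summable
import Mathlib.Analysis.SpecialFunctions.Pow.Real
import HarnessLib

/-!
# REPAIR-CATALOGUE rows RC-322 / RC-327 (Geiger 2026): Prop VII.1, the theta–eta product identity at the `l`-torsion points, PROVED for a real nome

Record file of the abc-iut cell, D-0123(C) REPAIR-CATALOGUE, floating tester abc-iut-rcat-tst-7 (source `paper:doi-10-5281-zenodo-20541632`, bib
`Geiger2026Cor312Gap`; the source's Prop VII.1 p.11 l.76–163 is a classical «by-product» — «This identity belongs to the classical eta-quotient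
corpus … the proof below is included for the convenience of the reader» — which the catalogue so far carried as «regression-checked to 7·10⁻¹⁵»,
kit j272183). TAKES NO SIDE on [IUTchIII] Cor. 3.12 / [IUTchIV] Thm. 1.10, on the source, or on any author; the `def`s are claim-tagged
transcriptions of the source's classical functions AT A REAL NOME `q = e^{2πiτ} ∈ (0,1)` (`τ ∈ iℝ_{>0}`), nothing is a Literature fact;
nothing here is a reading of print's Θ-pilot; nothing asserts abc proved or refuted.

OBJECTS (§3): `qPoch q = ∏'_m (1 − q^{m+1}) = (q;q)_∞`; `eta q = q^{1/24}·(q;q)_∞` (the Dedekind η as a function of the real nome);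
`zetaOf l = exp(2πi/l)`; `theta1At q l j = 2·q^{1/8}·sin(πj/l)·∏'_m (1 − q^{m+1})·‖1 − q^{m+1} ζ_l^j‖²` = the source's
`θ₁(j/l | τ) = 2 q^{1/8} sin(πz) ∏_n (1−q^n)(1−q^n e^{2πiz})(1−q^n e^{−2πiz})` at `z = j/l` (p.11 l.95–105) with the two conjugate factors
`(1 − q^n ζ^j)(1 − q^n ζ^{−j})` written as `‖1 − q^n ζ^j‖²` (equal for real `q`, `norm_cfactor`).
RESULT (§5): **`prod_theta1At_eq'`** — for `0 < q < 1` and `3 ≤ l`: `∏_{j=1}^{l−1} θ₁(j/l) = l · η(q)^{l−3} · η(q^l)²` (the source's (VII.1),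
`∏_{j=1}^{l−1} θ₁(j/l|τ) = l·η(τ)^{l−3}·η(lτ)²`, at a real nome; `η(lτ) ↔ eta (q^l)`). Ingredients: `prod_two_sin_eq` (`∏_{j=1}^{n} 2 sin(πj/(n+1)) =
n+1`, from `‖1 − ζ^j‖ = 2 sin(πj/(n+1))` and abc-iut-rcat-tst-2's cyclotomic lemma `ArchAvgProof.prod_norm_one_sub_pow_mul`, p511866);
`prod_Icc_norm_sq_eq` (`∏_{j=1}^{n} ‖1 − xζ^j‖² = (∑_{i<n+1} x^i)²`); `multipliable_one_sub_pow`; the geometric-sum identity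
`(∑_{i<l} x^i)(1 − x) = 1 − x^l`; `Multipliable.tprod_mul` / `tprod_pow`; real-power bookkeeping `(q^{1/8})^{l−1} = (q^{1/24})^{l−3}·((q^l)^{1/24})²`.
HONEST SCOPE: real nome only (the source states the identity for `τ ∈ ℍ`; the complex case differs only by the choice of branches of
`q^{1/8}`, `q^{1/24}`); classical content; as a repair candidate a constant (setting-blind) proposition (`RcatGeiger` §3).
[claim: Geiger2026Cor312Gap, status: under-review]
-/

noncomputable section

open Finset

namespace Summit.ABC.IUTFork.Repair.RcatGeiger.ThetaEta

open ArchAvgProof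

/-! ### Step 1: `∏_{j=1}^{n} 2 sin(π j/(n+1)) = n + 1` -/

/-- `‖1 − ζ^j‖ = 2 sin(π j/(n+1))` for `ζ = exp(2πi/(n+1))` and `1 ≤ j ≤ n`. [folklore] -/
theorem norm_one_sub_zeta_pow (n j : ℕ) (hj1 : 1 ≤ j) (hjn : j ≤ n) :
    ‖(1 : ℂ) - Complex.exp (2 * Real.pi * Complex.I / (n + 1 : ℕ)) ^ j‖
      = 2 * Real.sin (Real.pi * j / (n + 1)) := by
  have hx : Complex.exp (2 * Real.pi * Complex.I / (n + 1 : ℕ)) ^ j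
      = Complex.exp (Complex.I * ((2 * Real.pi * j / (n + 1) : ℝ) : ℂ)) := by
    rw [← Complex.exp_nat_mul]
    congr 1
    push_cast
    ring
  rw [hx, norm_sub_rev, Complex.norm_exp_I_mul_ofReal_sub_one]
  have harg : (2 * Real.pi * j / (n + 1) : ℝ) / 2 = Real.pi * j / (n + 1) := by ring
  rw [harg, Real.norm_eq_abs, abs_of_pos]
  have hpos : 0 < Real.sin (Real.pi * j / (n + 1)) := by
    apply Real.sin_pos_of_pos_of_lt_pi
    · have : (0 : ℝ) < j := by exact_mod_cast hj1
      positivity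
    · have hlt : (j : ℝ) < n + 1 := by exact_mod_cast Nat.lt_succ_of_le hjn
      have hn : (0 : ℝ) < n + 1 := by positivity
      rw [div_lt_iff₀ hn]
      nlinarith [Real.pi_pos]
  linarith

/-- `∏_{j=1}^{n} 2 sin(π j/(n+1)) = n + 1`. [folklore] -/
theorem prod_two_sin_eq (n : ℕ) :
    ∏ j ∈ Icc 1 n, (2 * Real.sin (Real.pi * j / (n + 1))) = n + 1 := by
  set ζ : ℂ := Complex.exp (2 * Real.pi * Complex.I / (n + 1 : ℕ)) with hζdef
  have hζ : IsPrimitiveRoot ζ (n + 1) := Complex.isPrimitiveRoot_exp (n + 1) (Nat.succ_ne_zero n)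
  have h := prod_norm_one_sub_pow_mul hζ 1
  simp only [one_pow, sum_const, card_range, Complex.ofReal_one, mul_one] at h
  -- h : ∏ k ∈ range n, ‖1 - ζ ^ (k + 1)‖ = |(n+1) • 1|
  rw [prod_Icc_one_eq_prod_range]
  have hk : ∀ k ∈ range n, 2 * Real.sin (Real.pi * ((k + 1 : ℕ) : ℝ) / (n + 1)) = ‖1 - ζ ^ (k + 1)‖ :=
    fun k hk => (norm_one_sub_zeta_pow n (k + 1) (by omega) (by have := mem_range.mp hk; omega)).symm
  rw [prod_congr rfl hk, h]
  simp only [nsmul_eq_mul, mul_one]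
  push_cast
  exact abs_of_nonneg (by positivity)

/-! ### Step 2: the per-`m` cyclotomic identity -/

/-- For `‖w‖ = 1` and real `x`: `‖1 − w⁻¹ x‖ = ‖1 − x w‖`. [folklore] -/
theorem norm_one_sub_inv_mul (w : ℂ) (hw : ‖w‖ = 1) (x : ℝ) :
    ‖(1 : ℂ) - w⁻¹ * (x : ℂ)‖ = ‖(1 : ℂ) - (x : ℂ) * w‖ := by
  have hconj : w⁻¹ = (starRingEnd ℂ) w := Complex.inv_eq_conj hw
  rw [hconj]
  have : (1 : ℂ) - (starRingEnd ℂ) w * (x : ℂ) = (starRingEnd ℂ) ((1 : ℂ) - (x : ℂ) * w) := by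
    simp [map_sub, map_mul, Complex.conj_ofReal, mul_comm]
  rw [this, Complex.norm_conj]

/-- `∏_{j=1}^{n} ‖1 − x ζ^j‖² = (∑_{i<n+1} x^i)²` for a primitive `(n+1)`-st root `ζ` and real `x`. [folklore] -/
theorem prod_Icc_norm_sq_eq {n : ℕ} {ζ : ℂ} (hζ : IsPrimitiveRoot ζ (n + 1)) (x : ℝ) :
    ∏ j ∈ Icc 1 n, ‖(1 : ℂ) - (x : ℂ) * ζ ^ j‖ ^ 2 = (∑ i ∈ range (n + 1), x ^ i) ^ 2 := by
  rw [prod_pow, prod_Icc_one_eq_prod_range]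
  have h := prod_norm_one_sub_pow_mul hζ x
  have hcomm : ∀ k : ℕ, ‖(1 : ℂ) - (x : ℂ) * ζ ^ (k + 1)‖ = ‖1 - ζ ^ (k + 1) * (x : ℂ)‖ := by
    intro k; rw [mul_comm]
  simp_rw [hcomm]
  rw [h, sq_abs]

/-! ### Step 3: the objects — `(q;q)_∞`, `η`, `θ₁` at the torsion points, for real `q` -/

/-- `(q;q)_∞ = ∏_{m≥1} (1 − q^m)` for real `q` (as `∏'_m (1 − q^{m+1})`). [claim: Geiger2026Cor312Gap, status: under-review] -/
@[claim "Geiger2026Cor312Gap" "under-review"] def qPoch (q : ℝ) : ℝ := ∏' m : ℕ, (1 - q ^ (m + 1))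

/-- The Dedekind `η` as a function of a REAL nome `q = e^{2πiτ}` (`τ ∈ iℝ_{>0}`): `η = q^{1/24}·(q;q)_∞` (source p.11 l.105).
[claim: Geiger2026Cor312Gap, status: under-review] -/
@[claim "Geiger2026Cor312Gap" "under-review"] def eta (q : ℝ) : ℝ := q ^ ((1 : ℝ) / 24) * qPoch q

/-- `ζ_l := exp(2πi/l)`. [folklore] -/
def zetaOf (l : ℕ) : ℂ := Complex.exp (2 * Real.pi * Complex.I / l)

/-- `θ₁(j/l | τ)` for a REAL nome `q ∈ (0,1)` (source p.11 l.95–105: `θ₁(z|τ) = 2 q^{1/8} sin(πz) ∏_n (1−q^n)(1−q^n e^{2πiz})(1−q^n e^{−2πiz})`),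
with the conjugate pair of factors written as `‖1 − q^n ζ_l^j‖²` (for real `q` the two factors are complex conjugates, so the product is real).
[claim: Geiger2026Cor312Gap, status: under-review] -/
@[claim "Geiger2026Cor312Gap" "under-review"] def theta1At (q : ℝ) (l j : ℕ) : ℝ :=
  2 * q ^ ((1 : ℝ) / 8) * Real.sin (Real.pi * j / l) *
    ∏' m : ℕ, ((1 - q ^ (m + 1)) * ‖(1 : ℂ) - ((q ^ (m + 1) : ℝ) : ℂ) * zetaOf l ^ j‖ ^ 2)

/-! ### Step 4: multipliability and the infinite-product identity -/

/-- `m ↦ 1 − x^{m+1}` is multipliable for `0 ≤ x < 1`. [folklore] -/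
theorem multipliable_one_sub_pow {x : ℝ} (hx0 : 0 ≤ x) (hx1 : x < 1) :
    Multipliable fun m : ℕ => (1 - x ^ (m + 1)) := by
  have h : (fun m : ℕ => (1 - x ^ (m + 1))) = fun m : ℕ => 1 + (-(x * x ^ m)) := by
    funext m; ring
  rw [h]
  apply Real.multipliable_one_add_of_summable
  exact ((summable_geometric_of_lt_one hx0 hx1).mul_left x).neg

/-- The complex factor whose norm is the real `m`-th factor of `theta1At`: `‖(1 − q^{m+1})(1 − w q^{m+1})(1 − w⁻¹ q^{m+1})‖ = (1 − q^{m+1})·‖1 − q^{m+1} w‖²` for `‖w‖ = 1`, `0 ≤ q < 1`. [folklore] -/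
theorem norm_cfactor {q : ℝ} (hq0 : 0 ≤ q) (hq1 : q < 1) {w : ℂ} (hw : ‖w‖ = 1) (m : ℕ) :
    ‖((1 : ℂ) - (q : ℂ) ^ (m + 1)) * ((1 - w * (q : ℂ) ^ (m + 1)) * (1 - w⁻¹ * (q : ℂ) ^ (m + 1)))‖
      = (1 - q ^ (m + 1)) * ‖(1 : ℂ) - ((q ^ (m + 1) : ℝ) : ℂ) * w‖ ^ 2 := by
  have hq' : ((q ^ (m + 1) : ℝ) : ℂ) = (q : ℂ) ^ (m + 1) := by push_cast; rfl
  rw [norm_mul, norm_mul]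
  have h1 : ‖(1 : ℂ) - (q : ℂ) ^ (m + 1)‖ = 1 - q ^ (m + 1) := by
    have : (1 : ℂ) - (q : ℂ) ^ (m + 1) = ((1 - q ^ (m + 1) : ℝ) : ℂ) := by push_cast; rfl
    rw [this, Complex.norm_real, Real.norm_eq_abs, abs_of_nonneg]
    have := pow_le_one₀ hq0 hq1.le (n := m + 1)
    linarith
  have h2 : ‖(1 : ℂ) - w * (q : ℂ) ^ (m + 1)‖ = ‖(1 : ℂ) - ((q ^ (m + 1) : ℝ) : ℂ) * w‖ := by
    rw [hq', mul_comm]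
  have h3 : ‖(1 : ℂ) - w⁻¹ * (q : ℂ) ^ (m + 1)‖ = ‖(1 : ℂ) - ((q ^ (m + 1) : ℝ) : ℂ) * w‖ := by
    rw [← hq']
    exact norm_one_sub_inv_mul w hw (q ^ (m + 1))
  rw [h1, h2, h3, sq]

/-! ### Step 5: Prop VII.1 -/

/-- **Prop VII.1 (theta–eta product identity), PROVED for a real nome** (source p.11 l.76–163, «∏_{j=1}^{l−1} θ₁(j/l|τ) = l·η(τ)^{l−3}·η(lτ)²»,
stated there for `τ ∈ ℍ`; here `q = e^{2πiτ} ∈ (0,1)` real, `l = k + 3 ≥ 3`): `∏_{j=1}^{l−1} θ₁(j/l) = l · η(q)^{l−3} · η(q^l)²`.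
[claim: Geiger2026Cor312Gap, status: under-review] -/
theorem prod_theta1At_eq {q : ℝ} (hq0 : 0 < q) (hq1 : q < 1) (k : ℕ) :
    ∏ j ∈ Icc 1 (k + 2), theta1At q (k + 3) j = ((k + 3 : ℕ) : ℝ) * eta q ^ k * eta (q ^ (k + 3)) ^ 2 := by
  -- the primitive root and the complex factors
  set ζ : ℂ := zetaOf (k + 3) with hζdef
  have hζ : IsPrimitiveRoot ζ (k + 2 + 1) := by
    rw [hζdef, zetaOf]; exact Complex.isPrimitiveRoot_exp (k + 3) (by omega)
  have hn1 : ‖ζ‖ = 1 := hζ.norm'_eq_one (Nat.succ_ne_zero _)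
  have hnj : ∀ j : ℕ, ‖ζ ^ j‖ = 1 := fun j => by rw [norm_pow, hn1, one_pow]
  set C : ℕ → ℕ → ℂ := fun j m =>
    ((1 : ℂ) - (q : ℂ) ^ (m + 1)) * ((1 - ζ ^ j * (q : ℂ) ^ (m + 1)) * (1 - (ζ ^ j)⁻¹ * (q : ℂ) ^ (m + 1))) with hC
  have hsumC : Summable fun m : ℕ => -(q : ℂ) ^ (m + 1) := by
    apply Summable.neg
    apply Summable.of_norm
    have : (fun m : ℕ => ‖(q : ℂ) ^ (m + 1)‖) = fun m : ℕ => q * q ^ m := by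
      funext m
      rw [norm_pow, Complex.norm_real, Real.norm_eq_abs, abs_of_nonneg hq0.le]; ring
    rw [this]
    exact (summable_geometric_of_lt_one hq0.le hq1).mul_left q
  have hmultC : ∀ j : ℕ, Multipliable (C j) := by
    intro j
    have h1 : Multipliable fun m : ℕ => (1 : ℂ) - (q : ℂ) ^ (m + 1) := by
      have := Complex.multipliable_one_add_of_summable hsumC
      simpa [sub_eq_add_neg] using this
    exact h1.mul (multipliable_thetaFactor hq0.le hq1 (hnj j))
  have hnormC : ∀ j m : ℕ, ‖C j m‖ = (1 - q ^ (m + 1)) * ‖(1 : ℂ) - ((q ^ (m + 1) : ℝ) : ℂ) * ζ ^ j‖ ^ 2 :=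
    fun j m => norm_cfactor hq0.le hq1 (hnj j) m
  -- (1) each θ₁(j/l) as 2 q^{1/8} sin · ‖∏' C j‖
  have hθ : ∀ j ∈ Icc 1 (k + 2), theta1At q (k + 3) j
      = (2 * Real.sin (Real.pi * j / ((k : ℝ) + 2 + 1))) * q ^ ((1 : ℝ) / 8) * ‖∏' m, C j m‖ := by
    intro j _
    rw [theta1At, ← (hasProd_norm_of_multipliable (hmultC j)).tprod_eq]
    simp_rw [hnormC]
    rw [← hζdef]
    push_cast
    ring
  have hsin : ∏ j ∈ Icc 1 (k + 2), (2 * Real.sin (Real.pi * j / ((k : ℝ) + 2 + 1))) = (k : ℝ) + 2 + 1 := by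
    have h := prod_two_sin_eq (k + 2)
    push_cast at h
    exact h
  rw [prod_congr rfl hθ, prod_mul_distrib, prod_mul_distrib, hsin, prod_const, Nat.card_Icc]
  -- (2) the j-product of the norms of the infinite products
  have hP : ∀ m : ℕ, ∏ j ∈ Icc 1 (k + 2), ‖C j m‖
      = (1 - q ^ (m + 1)) ^ k * (1 - (q ^ (k + 3)) ^ (m + 1)) ^ 2 := by
    intro m
    simp_rw [hnormC]
    rw [prod_mul_distrib, prod_const, Nat.card_Icc, prod_Icc_norm_sq_eq hζ (q ^ (m + 1))]
    have hgeom : (∑ i ∈ range (k + 2 + 1), (q ^ (m + 1)) ^ i) * (1 - q ^ (m + 1)) = 1 - (q ^ (k + 3)) ^ (m + 1) := by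
      rw [geom_sum_mul_neg, ← pow_mul, ← pow_mul]
      congr 1; congr 1; ring
    have hk2 : k + 2 + 1 - 1 = k + 2 := by omega
    rw [hk2, ← hgeom]
    ring
  have hH : HasProd (fun m => ∏ j ∈ Icc 1 (k + 2), ‖C j m‖) (∏ j ∈ Icc 1 (k + 2), ‖∏' m, C j m‖) :=
    hasProd_prod fun j _ => hasProd_norm_of_multipliable (hmultC j)
  have hV : ∏ j ∈ Icc 1 (k + 2), ‖∏' m, C j m‖
      = ∏' m : ℕ, ((1 - q ^ (m + 1)) ^ k * (1 - (q ^ (k + 3)) ^ (m + 1)) ^ 2) := by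
    rw [← hH.tprod_eq]; exact tprod_congr hP
  -- (3) split the infinite product
  have ha : Multipliable fun m : ℕ => (1 - q ^ (m + 1)) := multipliable_one_sub_pow hq0.le hq1
  have hb : Multipliable fun m : ℕ => (1 - (q ^ (k + 3)) ^ (m + 1)) :=
    multipliable_one_sub_pow (pow_nonneg hq0.le _) (pow_lt_one₀ hq0.le hq1 (by omega))
  have hsplit : ∏' m : ℕ, ((1 - q ^ (m + 1)) ^ k * (1 - (q ^ (k + 3)) ^ (m + 1)) ^ 2)
      = (qPoch q) ^ k * (qPoch (q ^ (k + 3))) ^ 2 := by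
    rw [(ha.pow k).tprod_mul (hb.pow 2), ha.tprod_pow k, hb.tprod_pow 2]
    rfl
  rw [hV, hsplit]
  -- (4) the powers of q
  unfold eta
  have hk1 : k + 2 + 1 - 1 = k + 2 := by omega
  rw [hk1, mul_pow, mul_pow]
  have hq8 : (q ^ ((1 : ℝ) / 8)) ^ (k + 2) = q ^ ((1 : ℝ) / 8 * ((k + 2 : ℕ) : ℝ)) :=
    (Real.rpow_mul_natCast hq0.le _ _).symm
  have hq24 : (q ^ ((1 : ℝ) / 24)) ^ k = q ^ ((1 : ℝ) / 24 * (k : ℝ)) :=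
    (Real.rpow_mul_natCast hq0.le _ _).symm
  have hql : ((q ^ (k + 3)) ^ ((1 : ℝ) / 24)) ^ 2 = q ^ ((((k + 3 : ℕ) : ℝ) * ((1 : ℝ) / 24)) * ((2 : ℕ) : ℝ)) := by
    rw [← Real.rpow_natCast q (k + 3), ← Real.rpow_mul hq0.le, ← Real.rpow_mul_natCast hq0.le]
  have hpow : (q ^ ((1 : ℝ) / 8)) ^ (k + 2) = (q ^ ((1 : ℝ) / 24)) ^ k * ((q ^ (k + 3)) ^ ((1 : ℝ) / 24)) ^ 2 := by
    rw [hq8, hq24, hql, ← Real.rpow_add hq0]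
    congr 1
    push_cast
    ring
  rw [hpow]
  push_cast
  ring

/-- Prop VII.1 in the source's indexing: for `0 < q < 1` and `3 ≤ l`, `∏_{j=1}^{l−1} θ₁(j/l) = l·η(q)^{l−3}·η(q^l)²`.
[claim: Geiger2026Cor312Gap, status: under-review] -/
theorem prod_theta1At_eq' {q : ℝ} (hq0 : 0 < q) (hq1 : q < 1) {l : ℕ} (hl : 3 ≤ l) :
    ∏ j ∈ Icc 1 (l - 1), theta1At q l j = (l : ℝ) * eta q ^ (l - 3) * eta (q ^ l) ^ 2 := by
  obtain ⟨k, rfl⟩ : ∃ k, l = k + 3 := ⟨l - 3, by omega⟩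
  have h1 : k + 3 - 1 = k + 2 := by omega
  have h3 : k + 3 - 3 = k := by omega
  rw [h1, h3]
  exact prod_theta1At_eq hq0 hq1 k

end Summit.ABC.IUTFork.Repair.RcatGeiger.ThetaEta

end
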